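import Summits.MatrixMultiplication.MatrixMultiplication.Theorems.AbelianSTPPCensusFP2Sound
import Summits.MatrixMultiplication.MatrixMultiplication.Theorems.AbelianSTPPCensusFP4Defs

/-!
# Rule U11-F4: the four cosets of the Sylow subgroup at `|H| = 4p`, labelled with an explicit addition table

Cell mm-stpp (rung F-M1), theory lane (seat mm-stpp-theory, gen 17).  The group-theoretic input of the soundness proof of rule U11-F4
(`AbelianSTPPCensusFP4Sound.lean`): in a finite abelian group `H` of order `4p`, `p` an odd prime, there are a subgroup `P` of order `p`
(Cauchy), a parameter `e ∈ {0, 1}`, a LABELLING `lab : H → {0,1,2,3}` of the four cosets of `P` and base points `base : ℕ → H` with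
`u − base (lab u) ∈ P`, such that `lab (u + v) = FP4.addQ e (lab u) (lab v)` and `lab (−u) = FP4.negQ e (lab u)` — i.e. `H/P` is `ℤ/4`
(`e = 1`) or `ℤ/2 × ℤ/2` (`e = 0`) with the labels of `AbelianSTPPCensusFP4Defs` (`FP4.Lab`, `FP4.nonempty_lab`).

Construction (elementary, no classification theorem invoked): `g` of order `p` and `k` of order `2` (Cauchy); `P = ℤg`;
`K = ℤ(g + k)` has order `2p` (coprime orders), hence index `2`, contains `g` and `k`, and every element of `K` lies in `P` or in `k + P`;
`h₀ ∉ K`; `e = 0` if `2h₀ ∈ P`, else `e = 1` (and then `2h₀ + k ∈ P`); labels `0, 1, 2, 3` = the cosets `P, k + P, h₀ + P, h₀ + k + P`.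
WHAT THIS IS NOT: no STPP content and no claim about the census; pure finite abelian group bookkeeping for the rule's soundness proof.
-/

set_option linter.dupNamespace false -- `MatrixMultiplication.MatrixMultiplication` (summit = problem, D-0017)
set_option autoImplicit false

namespace Summit.MatrixMultiplication.MatrixMultiplication.Theorems

open Finset

namespace FP4

/-! ### The labelling structure -/

/-- A labelling of the four cosets of a subgroup `P` of order `p` by `0..3` with addition table `addQ e` and base points
(`u − base (lab u) ∈ P`). [original] -/
structure Lab (H : Type*) [AddCommGroup H] [Fintype H] (p : ℕ) where
  /-- the subgroup of order `p` -/
  P : AddSubgroup H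
  /-- the table parameter: `1` = `ℤ/4`, `0` = Klein four group -/
  e : ℕ
  /-- the label of an element -/
  lab : H → ℕ
  /-- a base point of each labelled coset -/
  base : ℕ → H
  /-- `|P| = p` -/
  card_P : Nat.card P = p
  /-- `e ≤ 1` -/
  e_le : e ≤ 1
  /-- labels are `< 4` -/
  lab_lt : ∀ u, lab u < 4
  /-- the labelling is additive for the table `addQ e` -/
  lab_add : ∀ u v, lab (u + v) = addQ e (lab u) (lab v)
  /-- the labelling is compatible with negation -/
  lab_neg : ∀ u, lab (-u) = negQ e (lab u)
  /-- every element differs from the base point of its label by an element of `P` -/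
  sub_base : ∀ u, u - base (lab u) ∈ P

/-! ### Construction -/

section Construction

variable {H : Type*} [AddCommGroup H]

/-- Membership transported along an equation (helper for the table lemmas). [bookkeeping] -/
theorem mem_of_eq_of_mem {P : AddSubgroup H} {x y : H} (hy : y ∈ P) (hxy : x = y) : x ∈ P := hxy ▸ hy

/-- The four base points `0, k, h₀, h₀ + k`. [bookkeeping] -/
def base4 (h₀ k : H) : ℕ → H
  | 0 => 0
  | 1 => k
  | 2 => h₀
  | _ => h₀ + k

/-- The addition table on base points: `base a + base b − base (a + b) ∈ P`, from the two facts `2h₀ (+ k) ∈ P` and `k + k ∈ P`. [bookkeeping] -/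
theorem base4_add_mem (P : AddSubgroup H) {e : ℕ} (he : e ≤ 1) (h₀ k : H)
    (hF1 : (if e = 0 then h₀ + h₀ else h₀ + h₀ + k) ∈ P) (hF2 : k + k ∈ P) :
    ∀ a, a < 4 → ∀ b, b < 4 → base4 h₀ k a + base4 h₀ k b - base4 h₀ k (addQ e a b) ∈ P := by
  intro a ha b hb
  have h0 : (0 : H) ∈ P := P.zero_mem
  rcases Nat.le_one_iff_eq_zero_or_eq_one.mp he with rfl | rfl <;> simp only [if_true, if_false, Nat.one_ne_zero] at hF1 <;>
  · have hA := P.add_mem hF1 hF2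
    have hS := P.sub_mem hF1 hF2
    interval_cases a <;> interval_cases b <;> simp only [addQ, base4] <;> norm_num <;>
      first
      | exact mem_of_eq_of_mem h0 (by abel1)
      | exact mem_of_eq_of_mem hF2 (by abel1)
      | exact mem_of_eq_of_mem hF1 (by abel1)
      | exact mem_of_eq_of_mem hS (by abel1)
      | exact mem_of_eq_of_mem hA (by abel1)

/-- The negation table on base points: `base a + base (−a) ∈ P`. [bookkeeping] -/
theorem base4_neg_mem (P : AddSubgroup H) {e : ℕ} (he : e ≤ 1) (h₀ k : H)
    (hF1 : (if e = 0 then h₀ + h₀ else h₀ + h₀ + k) ∈ P) (hF2 : k + k ∈ P) :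
    ∀ a, a < 4 → base4 h₀ k a + base4 h₀ k (negQ e a) ∈ P := by
  intro a ha
  have h0 : (0 : H) ∈ P := P.zero_mem
  rcases Nat.le_one_iff_eq_zero_or_eq_one.mp he with rfl | rfl <;> simp only [if_true, if_false, Nat.one_ne_zero] at hF1 <;>
  · have hA := P.add_mem hF1 hF2
    have hS := P.sub_mem hF1 hF2
    interval_cases a <;> simp only [negQ, base4] <;> norm_num <;>
      first
      | exact mem_of_eq_of_mem h0 (by abel1)
      | exact mem_of_eq_of_mem hF2 (by abel1)
      | exact mem_of_eq_of_mem hF1 (by abel1)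
      | exact mem_of_eq_of_mem hS (by abel1)
      | exact mem_of_eq_of_mem hA (by abel1)

variable [Fintype H]

/-- **Existence of the labelling** at `|H| = 4p`, `p` an odd prime. [original] -/
theorem nonempty_lab {p : ℕ} (hM : Fintype.card H = 4 * p) (hp : p.Prime) (hp3 : 3 ≤ p) : Nonempty (Lab H p) := by
  classical
  haveI : Fact p.Prime := ⟨hp⟩
  have hp2 : p ≠ 2 := by omega
  have hcop : Nat.Coprime p 2 := (Nat.coprime_primes hp Nat.prime_two).mpr hp2
  -- Cauchy: `g` of order `p`, `k` of order `2`
  obtain ⟨g, hg⟩ := exists_prime_addOrderOf_dvd_card p (G := H) (by rw [hM]; exact Dvd.intro_left 4 rfl)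
  obtain ⟨k, hk⟩ := exists_prime_addOrderOf_dvd_card 2 (G := H) (by rw [hM]; exact Dvd.intro (2 * p) (by ring))
  set P := AddSubgroup.zmultiples g with hPdef
  have hPcard : Nat.card P = p := by rw [hPdef, Nat.card_zmultiples, hg]
  -- `K = ℤ(g + k)` has order `2p` and index `2`
  set K := AddSubgroup.zmultiples (g + k) with hKdef
  have hord : addOrderOf (g + k) = p * 2 := by
    have h := AddCommute.addOrderOf_add_eq_mul_addOrderOf_of_coprime (AddCommute.all g k) (by rw [hg, hk]; exact hcop)
    rw [h, hg, hk]
  have hKcard : Nat.card K = p * 2 := by rw [hKdef, Nat.card_zmultiples, hord]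
  have hidx : K.index = 2 := by
    have h1 := K.card_mul_index
    rw [hKcard, Nat.card_eq_fintype_card, hM] at h1
    have : p * 2 * K.index = p * 2 * 2 := by rw [h1]; ring
    exact Nat.eq_of_mul_eq_mul_left (by positivity) this
  have hK2 : ∀ u v : H, u + v ∈ K ↔ (u ∈ K ↔ v ∈ K) := fun u v => AddSubgroup.add_mem_iff_of_index_two hidx
  -- `2 • k = 0`, `k + k ∈ P`
  have h2k : k + k = 0 := by rw [← two_nsmul, ← hk, addOrderOf_nsmul_eq_zero]
  have hF2 : k + k ∈ P := by rw [h2k]; exact P.zero_mem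
  have h2mk : ∀ m : ℤ, (m + m) • k = 0 := fun m => by rw [add_zsmul, ← zsmul_add, h2k, zsmul_zero]
  -- `k ∉ P`
  have hkP : k ∉ P := by
    intro hmem
    have hd := addOrderOf_dvd_of_mem_zmultiples hmem
    rw [hk, hg] at hd
    exact hp2 ((Nat.prime_dvd_prime_iff_eq Nat.prime_two hp).mp hd).symm
  -- every element of `K` lies in `P` or in `k + P`
  have hdec : ∀ r ∈ K, r ∈ P ∨ r - k ∈ P := by
    intro r hr
    rw [hKdef, AddSubgroup.mem_zmultiples_iff] at hr
    obtain ⟨n, rfl⟩ := hr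
    rcases Int.even_or_odd n with ⟨m, rfl⟩ | ⟨m, rfl⟩
    · left
      have : (m + m) • (g + k) = (m + m) • g := by rw [zsmul_add, h2mk, add_zero]
      rw [this]
      exact P.zsmul_mem (AddSubgroup.mem_zmultiples g) _
    · right
      have hk' : (2 * m + 1) • k = k := by rw [add_zsmul, one_zsmul, two_mul, h2mk, zero_add]
      have : (2 * m + 1) • (g + k) - k = (2 * m + 1) • g := by rw [zsmul_add, hk', add_sub_cancel_right]
      rw [this]
      exact P.zsmul_mem (AddSubgroup.mem_zmultiples g) _
  -- `P ≤ K` and `k ∈ K`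
  have hpodd : Odd p := hp.odd_of_ne_two hp2
  have hkK : k ∈ K := by
    rw [hKdef, AddSubgroup.mem_zmultiples_iff]
    refine ⟨(p : ℤ), ?_⟩
    rw [smul_add, natCast_zsmul, natCast_zsmul, ← hg, addOrderOf_nsmul_eq_zero, zero_add, hg]
    obtain ⟨m, hm⟩ := hpodd
    rw [hm, add_nsmul, one_nsmul, mul_nsmul, two_nsmul, h2k, nsmul_zero, zero_add]
  have hgK : g ∈ K := by
    have : g = (g + k) - k := by abel
    rw [this]
    exact K.sub_mem (AddSubgroup.mem_zmultiples _) hkK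
  have hPK : ∀ u, u ∈ P → u ∈ K := by
    intro u hu
    rw [hPdef, AddSubgroup.mem_zmultiples_iff] at hu
    obtain ⟨n, rfl⟩ := hu
    exact K.zsmul_mem hgK n
  -- `h₀ ∉ K`
  have hKtop : K ≠ ⊤ := by
    intro htop
    rw [htop, AddSubgroup.index_top] at hidx
    exact absurd hidx (by norm_num)
  obtain ⟨h₀, hh₀⟩ : ∃ h₀ : H, h₀ ∉ K := by
    by_contra hall
    exact hKtop (eq_top_iff.mpr fun u _ => by by_contra hu; exact hall ⟨u, hu⟩)
  -- the table parameter
  set e : ℕ := if h₀ + h₀ ∈ P then 0 else 1 with hedef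
  have he : e ≤ 1 := by rw [hedef]; split_ifs <;> omega
  have h2h₀K : h₀ + h₀ ∈ K := (hK2 h₀ h₀).mpr Iff.rfl
  have hF1 : (if e = 0 then h₀ + h₀ else h₀ + h₀ + k) ∈ P := by
    by_cases hc : h₀ + h₀ ∈ P
    · have : e = 0 := by rw [hedef, if_pos hc]
      rw [if_pos this]; exact hc
    · have : e = 1 := by rw [hedef, if_neg hc]
      rw [if_neg (by omega)]
      rcases hdec _ h2h₀K with h | h
      · exact absurd h hc
      · have : h₀ + h₀ + k = (h₀ + h₀ - k) + (k + k) := by abel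
        rw [this]; exact P.add_mem h hF2
  -- the labelling
  let lab : H → ℕ := fun u => if u ∈ P then 0 else if u - k ∈ P then 1 else if u - h₀ ∈ P then 2 else 3
  have hlab_lt : ∀ u, lab u < 4 := by intro u; simp only [lab]; split_ifs <;> omega
  have hsub : ∀ u, u - base4 h₀ k (lab u) ∈ P := by
    intro u
    simp only [lab]
    split_ifs with h1 h2 h3
    · simpa [base4] using h1
    · simpa [base4] using h2
    · simpa [base4] using h3
    · show u - (h₀ + k) ∈ P
      have huK : u ∉ K := fun huK => by
        rcases hdec u huK with h | h
        · exact h1 h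
        · exact h2 h
      have huh : u - h₀ ∈ K := by
        rw [sub_eq_add_neg, hK2]
        exact ⟨fun h => absurd h huK, fun h => absurd (K.neg_mem_iff.mp h) hh₀⟩
      rcases hdec _ huh with h | h
      · exact absurd h h3
      · have : u - (h₀ + k) = u - h₀ - k := by abel
        rw [this]; exact h
  -- uniqueness of labels
  have hh₀P : ∀ x, x ∈ P → ∀ y, y ∈ K → h₀ ≠ x + y := by
    rintro x hx y hy rfl
    exact hh₀ (K.add_mem (hPK x hx) hy)
  have huniq : ∀ u (l : ℕ), l < 4 → u - base4 h₀ k l ∈ P → lab u = l := by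
    intro u l hl hu
    have hnk : k ∈ K := hkK
    have hnk' : -k ∈ K := K.neg_mem hkK
    have h0K : (0 : H) ∈ K := K.zero_mem
    simp only [lab]
    match l, hl with
    | 0, _ =>
      rw [if_pos (by simpa [base4] using hu)]
    | 1, _ =>
      change u - k ∈ P at hu
      have n0 : u ∉ P := fun h => hkP (by have := P.sub_mem h hu; rwa [sub_sub_cancel] at this)
      rw [if_neg n0, if_pos hu]
    | 2, _ =>
      change u - h₀ ∈ P at hu
      have n0 : u ∉ P := fun h => hh₀P _ (P.sub_mem h hu) 0 h0K (by abel)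
      have n1 : u - k ∉ P := fun h => hh₀P _ (P.sub_mem h hu) k hnk (by abel)
      rw [if_neg n0, if_neg n1, if_pos hu]
    | 3, _ =>
      change u - (h₀ + k) ∈ P at hu
      have n0 : u ∉ P := fun h => hh₀P _ (P.sub_mem h hu) (-k) hnk' (by abel)
      have n1 : u - k ∉ P := fun h => hh₀P _ (P.sub_mem h hu) 0 h0K (by abel)
      have n2 : u - h₀ ∉ P := fun h => hkP (by have := P.sub_mem h hu; convert this using 1; abel)
      rw [if_neg n0, if_neg n1, if_neg n2]
  have haddQ_lt : ∀ a, a < 4 → ∀ b, b < 4 → addQ e a b < 4 := by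
    have : ∀ e < 2, ∀ a < 4, ∀ b < 4, addQ e a b < 4 := by decide
    exact this e (by omega)
  have hnegQ_lt : ∀ a, a < 4 → negQ e a < 4 := by
    have : ∀ e < 2, ∀ a < 4, negQ e a < 4 := by decide
    exact this e (by omega)
  refine ⟨⟨P, e, lab, base4 h₀ k, hPcard, he, hlab_lt, ?_, ?_, hsub⟩⟩
  · -- additivity
    intro u v
    refine huniq (u + v) _ (haddQ_lt _ (hlab_lt u) _ (hlab_lt v)) ?_
    have ht := base4_add_mem P he h₀ k hF1 hF2 _ (hlab_lt u) _ (hlab_lt v)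
    have := P.add_mem (P.add_mem (hsub u) (hsub v)) ht
    convert this using 1
    abel
  · -- negation
    intro u
    refine huniq (-u) _ (hnegQ_lt _ (hlab_lt u)) ?_
    have ht := base4_neg_mem P he h₀ k hF1 hF2 _ (hlab_lt u)
    have := P.sub_mem (P.neg_mem (hsub u)) ht
    convert this using 1
    abel

end Construction

/-! ### Consequences used by the soundness proof -/

section Facts

variable {H : Type*} [AddCommGroup H] [Fintype H] {p : ℕ} (L : Lab H p)

/-- `|P| = p` as a filter count (any decidability instance). [bookkeeping] -/
theorem Lab.card_filter_mem_P [DecidablePred (· ∈ L.P)] : (univ.filter (· ∈ L.P)).card = p := by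
  rw [← Fintype.card_subtype, ← Nat.card_eq_fintype_card]
  exact L.card_P

/-- A labelled class of a finset lies in a translate of `P`, so it has at most `p` elements. [bookkeeping] -/
theorem Lab.card_filter_le (S : Finset H) (l : ℕ) : (S.filter (fun u => L.lab u = l)).card ≤ p := by
  classical
  calc (S.filter (fun u => L.lab u = l)).card ≤ (univ.filter (· ∈ L.P)).card := by
        refine card_le_card_of_injOn (fun u => u - L.base l) (fun u hu => ?_) (fun u _ v _ huv => sub_left_injective huv)
        rw [mem_coe, mem_filter] at hu
        rw [mem_coe, mem_filter]
        exact ⟨mem_univ _, hu.2 ▸ L.sub_base u⟩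
    _ = p := L.card_filter_mem_P

/-- Elements of one labelled class differ from its base point by elements of `P`. [bookkeeping] -/
theorem Lab.sub_base_of_mem_filter (S : Finset H) (l : ℕ) : ∀ u ∈ S.filter (fun u => L.lab u = l), u - L.base l ∈ L.P := by
  intro u hu
  rw [mem_filter] at hu
  exact hu.2 ▸ L.sub_base u

/-- The labels partition a finset: `|S| = Σ_{l < 4} |S ∩ lab⁻¹ l|`, written with the four classes. [bookkeeping] -/
theorem Lab.card_eq_sum_filter (S : Finset H) :
    S.card = (S.filter (fun u => L.lab u = 0)).card + (S.filter (fun u => L.lab u = 1)).card +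
      (S.filter (fun u => L.lab u = 2)).card + (S.filter (fun u => L.lab u = 3)).card := by
  classical
  have h := card_eq_sum_card_fiberwise (f := L.lab) (s := S) (t := range 4) fun u _ => mem_range.mpr (L.lab_lt u)
  rw [h, Finset.sum_range_succ, Finset.sum_range_succ, Finset.sum_range_succ, Finset.sum_range_succ, Finset.sum_range_zero,
    zero_add]

/-- The label of a negative. [bookkeeping] -/
theorem Lab.card_filter_neg [DecidableEq H] (S : Finset H) {l : ℕ} (hl : l < 4) :
    ((S.image (fun u => -u)).filter (fun u => L.lab u = l)).card = (S.filter (fun u => L.lab u = negQ L.e l)).card := by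
  classical
  have hinv : ∀ g, g < 4 → negQ L.e (negQ L.e g) = g := by
    have : ∀ e < 2, ∀ g < 4, negQ e (negQ e g) = g := by decide
    exact this L.e (by have := L.e_le; omega)
  rw [filter_image, card_image_of_injective _ neg_injective]
  congr 1
  ext u
  simp only [mem_filter, L.lab_neg]
  constructor
  · rintro ⟨hu, h⟩; exact ⟨hu, by rw [← h, hinv _ (L.lab_lt u)]⟩
  · rintro ⟨hu, h⟩; exact ⟨hu, by rw [h, hinv _ hl]⟩

end Facts

end FP4

end Summit.MatrixMultiplication.MatrixMultiplication.Theorems
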